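import Literature.Geometry.Lorentzian.ObstructionFreeGluing
import Literature.NumberTheory.Transcendental.MultipleZetaRepeatedTwosProofs
import Mathlib

/-!
# `ParametricKerrBurial`, line `receding-annulus-universal-collar` — stub `stub_bulkRing` (BK3a)
# (crux item stmt-FinalStateConjecture-10052), the registered statement proved

Geometry of the regular `N`-gon of puncture directions `ĉ_k = cos(2πk/N) e₀ + sin(2πk/N) e₁` (`N ≥ 3`) used by the
Brill–Lindquist bulk of the line: unit norms, `N`-periodicity, the chord length `‖ĉ_j − ĉ_k‖ = 2|sin(π(k − j)/N)|`
(§1), the separation `‖ĉ_j − ĉ_k‖ ≥ 4/N` for indices distinct mod `N` (Jordan's inequality `sin x ≥ 2x/π` on `[0, π/2]`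
and `sin(π − x) = sin x`, §2), the `D_N`-symmetry of the Coulomb sums `Σ_{k ≠ j} f(‖ĉ_j − ĉ_k‖)` (re-indexing
`k ↦ (k − j) mod N`, §3), and the orders of `T_N = Σ_{k=1}^{N−1} ‖ĉ_0 − ĉ_k‖⁻¹`, `U_N = Σ ‖·‖⁻²`, `V_N = Σ ‖·‖⁻³`:
`(N/2π) log(N/2) ≤ T_N ≤ N(1 + log N)`, `U_N ≤ N²`, `V_N ≤ N³` (per-term bound
`‖ĉ_0 − ĉ_k‖⁻ᵖ ≤ (N/4k)ᵖ + (N/4(N − k))ᵖ`, reflection `k ↔ N − k`, and Mathlib's harmonic bounds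
`log(n + 1) ≤ H_n ≤ 1 + log n` and the tree's `MZV.sum_Ico_inv_sq_le_two` (`Σ 1/k² ≤ 2`), §4). Everything is
elementary; no named facts.

References: the crux directory's `PICKED.md`; Mathlib `Real.mul_le_sin`, `harmonic_le_one_add_log`,
`log_add_one_le_harmonic`; `Literature/NumberTheory/Transcendental/MultipleZetaRepeatedTwosProofs.lean`
(`sum_Ico_inv_sq_le_two`).
-/

set_option linter.dupNamespace false

noncomputable section

namespace Summit.FinalStateConjecture.FinalStateConjecture.Theorems.SwallowTheDatum.ParametricKerrBurial

open scoped Manifold ContDiff Topology BigOperators InnerProductSpace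
open Bundle Set Filter Function MeasureTheory Literature.Geometry.Lorentzian
open Literature.Geometry.Lorentzian.MaoOhTao Literature.Geometry.Lorentzian.InitialDataSet
open Literature.NumberTheory.Transcendental.MZV (sum_Ico_inv_sq_le_two)

variable {N : ℕ} {c : ℕ → E3}

/-! ## §1 Planar vectors, the chord length, unit norms, periodicity -/

/-- `‖a e₀ + b e₁‖² = a² + b²` in `ℝ³`. [folklore] -/
theorem bulkRing_normSq (a b : ℝ) : ‖a • e 0 + b • e 1‖ ^ 2 = a ^ 2 + b ^ 2 := by
  rw [EuclideanSpace.real_norm_sq_eq]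
  simp [Fin.sum_univ_three, e]

/-- **Chord length** of the regular `N`-gon: `‖ĉ_a − ĉ_b‖ = 2 |sin(π(b − a)/N)|`. [folklore] -/
theorem bulkRing_chord
    (hc : ∀ k : ℕ, c k = Real.cos (2 * Real.pi * k / N) • e 0 + Real.sin (2 * Real.pi * k / N) • e 1)
    (a b : ℕ) : ‖c a - c b‖ = 2 * |Real.sin (Real.pi * ((b : ℝ) - a) / N)| := by
  have hsq : ‖c a - c b‖ ^ 2 = (2 * |Real.sin (Real.pi * ((b : ℝ) - a) / N)|) ^ 2 := by
    rw [hc a, hc b, mul_pow, sq_abs,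
      show ∀ p q r s : ℝ, (p • e 0 + q • e 1) - (r • e 0 + s • e 1) = (p - r) • e 0 + (q - s) • e 1 from
        fun p q r s ↦ by rw [sub_smul, sub_smul]; abel, bulkRing_normSq]
    have e1 := Real.sin_sq_add_cos_sq (2 * Real.pi * a / N)
    have e2 := Real.sin_sq_add_cos_sq (2 * Real.pi * b / N)
    have e3 := Real.cos_sub (2 * Real.pi * b / N) (2 * Real.pi * a / N)
    have e4 : Real.cos (2 * Real.pi * b / N - 2 * Real.pi * a / N) =
        2 * Real.cos (Real.pi * ((b : ℝ) - a) / N) ^ 2 - 1 := by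
      rw [← Real.cos_two_mul]; congr 1; ring
    have e5 := Real.sin_sq_add_cos_sq (Real.pi * ((b : ℝ) - a) / N)
    linear_combination e1 + e2 + 2 * e3 - 2 * e4 - 4 * e5
  calc ‖c a - c b‖ = Real.sqrt (‖c a - c b‖ ^ 2) := (Real.sqrt_sq (norm_nonneg _)).symm
    _ = _ := by rw [hsq, Real.sqrt_sq (by positivity)]

/-- Translation invariance of the chord length: `‖ĉ_a − ĉ_{a+d}‖ = ‖ĉ_0 − ĉ_d‖`. [folklore] -/
theorem bulkRing_chord_shift
    (hc : ∀ k : ℕ, c k = Real.cos (2 * Real.pi * k / N) • e 0 + Real.sin (2 * Real.pi * k / N) • e 1)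
    (a d : ℕ) : ‖c a - c (a + d)‖ = ‖c 0 - c d‖ := by
  rw [bulkRing_chord hc, bulkRing_chord hc]
  congr 3; push_cast; ring

/-- The chord from `ĉ_0`: `‖ĉ_0 − ĉ_d‖ = 2 sin(πd/N)` for `d ≤ N`. [folklore] -/
theorem bulkRing_chord_zero
    (hc : ∀ k : ℕ, c k = Real.cos (2 * Real.pi * k / N) • e 0 + Real.sin (2 * Real.pi * k / N) • e 1)
    {d : ℕ} (hd : d ≤ N) : ‖c 0 - c d‖ = 2 * Real.sin (Real.pi * d / N) := by
  rw [bulkRing_chord hc, Nat.cast_zero, sub_zero, abs_of_nonneg]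
  refine Real.sin_nonneg_of_nonneg_of_le_pi (by positivity) ?_
  rcases Nat.eq_zero_or_pos N with rfl | hN
  · simp [Real.pi_pos.le]
  · rw [div_le_iff₀ (by exact_mod_cast hN)]
    exact mul_le_mul_of_nonneg_left (by exact_mod_cast hd) Real.pi_pos.le

/-- **Unit norms**: `‖ĉ_k‖ = 1`. [folklore] -/
theorem bulkRing_norm_one
    (hc : ∀ k : ℕ, c k = Real.cos (2 * Real.pi * k / N) • e 0 + Real.sin (2 * Real.pi * k / N) • e 1)
    (k : ℕ) : ‖c k‖ = 1 := by
  have h : ‖c k‖ ^ 2 = 1 := by rw [hc k, bulkRing_normSq, Real.cos_sq_add_sin_sq]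
  rw [← Real.sqrt_sq (norm_nonneg (c k)), h, Real.sqrt_one]

/-- **`N`-periodicity**: `ĉ_{k+N} = ĉ_k`. [folklore] -/
theorem bulkRing_periodic (hN : 3 ≤ N)
    (hc : ∀ k : ℕ, c k = Real.cos (2 * Real.pi * k / N) • e 0 + Real.sin (2 * Real.pi * k / N) • e 1)
    (k : ℕ) : c (k + N) = c k := by
  have hN' : (N : ℝ) ≠ 0 := by exact_mod_cast (show N ≠ 0 by omega)
  have h : 2 * Real.pi * ((k + N : ℕ) : ℝ) / N = 2 * Real.pi * k / N + 2 * Real.pi := by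
    push_cast; field_simp
  rw [hc, hc k, h, Real.cos_add_two_pi, Real.sin_add_two_pi]

/-! ## §2 Jordan's inequality and the separation `4/N` -/

/-- Two-sided Jordan bound on `(0, π)`: for `1 ≤ d < N`, `sin(πd/N) ≥ 2d/N` or `sin(πd/N) ≥ 2(N − d)/N`
(the first for `2d ≤ N`, the second, via `sin(π − x) = sin x`, for `2d > N`). [folklore] -/
theorem bulkRing_sin_lower {N d : ℕ} (hd : 1 ≤ d) (hdN : d < N) :
    2 * (d : ℝ) / N ≤ Real.sin (Real.pi * d / N) ∨
      2 * ((N : ℝ) - d) / N ≤ Real.sin (Real.pi * d / N) := by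
  have hN : (0 : ℝ) < N := by exact_mod_cast (show 0 < N by omega)
  have hπ := Real.pi_pos
  rcases le_or_gt (2 * d) N with h | h
  · left
    have h1 : Real.pi * d / N ≤ Real.pi / 2 := by
      rw [div_le_div_iff₀ hN two_pos]
      have : (2 * d : ℝ) ≤ N := by exact_mod_cast h
      nlinarith
    calc 2 * (d : ℝ) / N = 2 / Real.pi * (Real.pi * d / N) := by field_simp
      _ ≤ _ := Real.mul_le_sin (by positivity) h1
  · right
    have hdN' : (d : ℝ) < N := by exact_mod_cast hdN
    have h1 : Real.pi * ((N : ℝ) - d) / N ≤ Real.pi / 2 := by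
      rw [div_le_div_iff₀ hN two_pos]
      have : (N : ℝ) < 2 * d := by exact_mod_cast h
      nlinarith
    have h0 : 0 ≤ Real.pi * ((N : ℝ) - d) / N := div_nonneg (mul_nonneg hπ.le (by linarith)) hN.le
    have h2 := Real.mul_le_sin h0 h1
    rw [show Real.pi * ((N : ℝ) - d) / N = Real.pi - Real.pi * d / N by field_simp,
      Real.sin_pi_sub] at h2
    calc 2 * ((N : ℝ) - d) / N = 2 / Real.pi * (Real.pi - Real.pi * d / N) := by field_simp
      _ ≤ _ := h2

/-- The chord from `ĉ_0` is `≥ 4d/N` or `≥ 4(N − d)/N` (`1 ≤ d < N`). [folklore] -/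
theorem bulkRing_dist_lower
    (hc : ∀ k : ℕ, c k = Real.cos (2 * Real.pi * k / N) • e 0 + Real.sin (2 * Real.pi * k / N) • e 1)
    {d : ℕ} (hd : 1 ≤ d) (hdN : d < N) :
    4 * (d : ℝ) / N ≤ ‖c 0 - c d‖ ∨ 4 * ((N : ℝ) - d) / N ≤ ‖c 0 - c d‖ := by
  rw [bulkRing_chord_zero hc hdN.le]
  rcases bulkRing_sin_lower hd hdN with h | h
  · left; rw [show (4 : ℝ) * d / N = 2 * (2 * (d : ℝ) / N) by ring]; linarith
  · right; rw [show (4 : ℝ) * ((N : ℝ) - d) / N = 2 * (2 * ((N : ℝ) - d) / N) by ring]; linarith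

/-- **Separation**: `‖ĉ_j − ĉ_k‖ ≥ 4/N` for `j < k < j + N`. [folklore] -/
theorem bulkRing_sep
    (hc : ∀ k : ℕ, c k = Real.cos (2 * Real.pi * k / N) • e 0 + Real.sin (2 * Real.pi * k / N) • e 1)
    {j k : ℕ} (hjk : j < k) (hkj : k < j + N) : (4 : ℝ) / N ≤ ‖c j - c k‖ := by
  obtain ⟨d, rfl⟩ : ∃ d, k = j + d := ⟨k - j, by omega⟩
  rw [bulkRing_chord_shift hc]
  have hd : 1 ≤ d := by omega
  have hdN : d < N := by omega
  have hN : (0 : ℝ) < N := by exact_mod_cast (show 0 < N by omega)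
  have hd' : (1 : ℝ) ≤ d := by exact_mod_cast hd
  have hdN' : (1 : ℝ) ≤ (N : ℝ) - d := by
    have : ((d + 1 : ℕ) : ℝ) ≤ N := by exact_mod_cast hdN
    push_cast at this; linarith
  have h1 : (4 : ℝ) / N ≤ 4 * d / N := div_le_div_of_nonneg_right (by linarith) hN.le
  have h2 : (4 : ℝ) / N ≤ 4 * ((N : ℝ) - d) / N := div_le_div_of_nonneg_right (by linarith) hN.le
  rcases bulkRing_dist_lower hc hd hdN with h | h <;> linarith

/-! ## §3 The `D_N`-symmetry of the Coulomb sums -/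

/-- **`D_N`-symmetry**: `Σ_{k ∈ [1,N], k ≠ j} f(‖ĉ_j − ĉ_k‖) = Σ_{m=1}^{N−1} f(‖ĉ_0 − ĉ_m‖)` for `j ∈ [1, N]`
(re-index `k ↦ (k − j) mod N`, translation invariance and periodicity). [folklore] -/
theorem bulkRing_sum_symm (hN : 3 ≤ N)
    (hc : ∀ k : ℕ, c k = Real.cos (2 * Real.pi * k / N) • e 0 + Real.sin (2 * Real.pi * k / N) • e 1)
    (f : ℝ → ℝ) {j : ℕ} (hj : j ∈ Finset.Icc 1 N) :
    ∑ k ∈ (Finset.Icc 1 N).erase j, f ‖c j - c k‖ = ∑ k ∈ Finset.Ico 1 N, f ‖c 0 - c k‖ := by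
  rw [Finset.mem_Icc] at hj
  refine Finset.sum_nbij' (fun k ↦ if j < k then k - j else k + N - j)
    (fun m ↦ if m + j ≤ N then m + j else m + j - N) ?_ ?_ ?_ ?_ ?_
  · intro k hk
    rw [Finset.mem_erase, Finset.mem_Icc] at hk
    rw [Finset.mem_Ico]
    split_ifs <;> omega
  · intro m hm
    rw [Finset.mem_Ico] at hm
    rw [Finset.mem_erase, Finset.mem_Icc]
    split_ifs <;> omega
  · intro k hk
    rw [Finset.mem_erase, Finset.mem_Icc] at hk
    split_ifs <;> omega
  · intro m hm
    rw [Finset.mem_Ico] at hm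
    split_ifs <;> omega
  · intro k hk
    rw [Finset.mem_erase, Finset.mem_Icc] at hk
    split_ifs with h
    · obtain ⟨d, rfl⟩ : ∃ d, k = j + d := ⟨k - j, by omega⟩
      rw [add_tsub_cancel_left, bulkRing_chord_shift hc]
    · obtain ⟨d, hd⟩ : ∃ d, k + N = j + d := ⟨k + N - j, by omega⟩
      rw [show k + N - j = d by omega, ← bulkRing_periodic hN hc k, hd, bulkRing_chord_shift hc]

/-! ## §4 The orders of `T_N`, `U_N`, `V_N` -/

/-- Reflection `k ↔ N − k` of a sum over `[1, N−1]`. [folklore] -/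
theorem bulkRing_sum_reflect (N : ℕ) (g : ℝ → ℝ) :
    ∑ k ∈ Finset.Ico 1 N, g ((N : ℝ) - k) = ∑ k ∈ Finset.Ico 1 N, g k := by
  refine Finset.sum_nbij' (fun k ↦ N - k) (fun k ↦ N - k) ?_ ?_ ?_ ?_ ?_
  · intro k hk; rw [Finset.mem_Ico] at hk ⊢; omega
  · intro k hk; rw [Finset.mem_Ico] at hk ⊢; omega
  · intro k hk; rw [Finset.mem_Ico] at hk; omega
  · intro k hk; rw [Finset.mem_Ico] at hk; omega
  · intro k hk; rw [Finset.mem_Ico] at hk; rw [Nat.cast_sub hk.2.le]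

/-- `(aᵖ)⁻¹ ≤ (t⁻¹)ᵖ` for `0 < t ≤ a`. [folklore] -/
theorem bulkRing_inv_pow_le {a t : ℝ} (ht : 0 < t) (h : t ≤ a) (p : ℕ) : (a ^ p)⁻¹ ≤ t⁻¹ ^ p := by
  rw [← inv_pow]
  exact pow_le_pow_left₀ (inv_nonneg.2 (ht.le.trans h)) (inv_anti₀ ht h) p

/-- Per-term bound: `‖ĉ_0 − ĉ_k‖⁻ᵖ ≤ (N/4k)ᵖ + (N/4(N − k))ᵖ` for `1 ≤ k < N`. [folklore] -/
theorem bulkRing_term_bound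
    (hc : ∀ k : ℕ, c k = Real.cos (2 * Real.pi * k / N) • e 0 + Real.sin (2 * Real.pi * k / N) • e 1)
    {k : ℕ} (hk : k ∈ Finset.Ico 1 N) (p : ℕ) :
    (‖c 0 - c k‖ ^ p)⁻¹ ≤ ((N : ℝ) / (4 * k)) ^ p + ((N : ℝ) / (4 * ((N : ℝ) - k))) ^ p := by
  rw [Finset.mem_Ico] at hk
  have hk0 : (0 : ℝ) < k := by exact_mod_cast hk.1
  have hNk : (0 : ℝ) < (N : ℝ) - k := sub_pos.2 (by exact_mod_cast hk.2)
  have hN : (0 : ℝ) < N := by exact_mod_cast (show 0 < N by omega)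
  have hA : 0 ≤ ((N : ℝ) / (4 * k)) ^ p := by positivity
  have hB : 0 ≤ ((N : ℝ) / (4 * ((N : ℝ) - k))) ^ p := pow_nonneg (div_nonneg hN.le (by linarith)) p
  rcases bulkRing_dist_lower hc hk.1 hk.2 with h | h
  · calc (‖c 0 - c k‖ ^ p)⁻¹ ≤ (4 * (k : ℝ) / N)⁻¹ ^ p := bulkRing_inv_pow_le (by positivity) h p
      _ = ((N : ℝ) / (4 * k)) ^ p := by rw [inv_div]
      _ ≤ _ := le_add_of_nonneg_right hB
  · calc (‖c 0 - c k‖ ^ p)⁻¹ ≤ (4 * ((N : ℝ) - k) / N)⁻¹ ^ p :=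
          bulkRing_inv_pow_le (div_pos (by linarith) hN) h p
      _ = ((N : ℝ) / (4 * ((N : ℝ) - k))) ^ p := by rw [inv_div]
      _ ≤ _ := le_add_of_nonneg_left hA

/-- Sum bound: `Σ_{k=1}^{N−1} ‖ĉ_0 − ĉ_k‖⁻ᵖ ≤ 2 (N/4)ᵖ Σ_{k=1}^{N−1} k⁻ᵖ`. [folklore] -/
theorem bulkRing_sum_bound
    (hc : ∀ k : ℕ, c k = Real.cos (2 * Real.pi * k / N) • e 0 + Real.sin (2 * Real.pi * k / N) • e 1)
    (p : ℕ) :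
    ∑ k ∈ Finset.Ico 1 N, (‖c 0 - c k‖ ^ p)⁻¹ ≤
      2 * ((N : ℝ) / 4) ^ p * ∑ k ∈ Finset.Ico 1 N, ((k : ℝ) ^ p)⁻¹ := by
  calc ∑ k ∈ Finset.Ico 1 N, (‖c 0 - c k‖ ^ p)⁻¹
      ≤ ∑ k ∈ Finset.Ico 1 N, (((N : ℝ) / (4 * k)) ^ p + ((N : ℝ) / (4 * ((N : ℝ) - k))) ^ p) :=
        Finset.sum_le_sum fun k hk ↦ bulkRing_term_bound hc hk p
    _ = 2 * ∑ k ∈ Finset.Ico 1 N, ((N : ℝ) / (4 * k)) ^ p := by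
        rw [Finset.sum_add_distrib, two_mul, bulkRing_sum_reflect N (fun x ↦ ((N : ℝ) / (4 * x)) ^ p)]
    _ = _ := by
        rw [Finset.mul_sum, Finset.mul_sum]
        exact Finset.sum_congr rfl fun k _ ↦ by ring

/-- `Σ_{k=1}^{N−1} 1/k ≤ 1 + log N` (`N ≥ 3`), from `H_n ≤ 1 + log n`. [folklore] -/
theorem bulkRing_harmonic_upper (hN : 3 ≤ N) :
    ∑ k ∈ Finset.Ico 1 N, ((k : ℝ))⁻¹ ≤ 1 + Real.log N := by
  obtain ⟨n, rfl⟩ : ∃ n, N = n + 1 := ⟨N - 1, by omega⟩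
  have h := harmonic_le_one_add_log n
  rw [harmonic_eq_sum_Icc] at h
  push_cast at h
  rw [Finset.Ico_add_one_right_eq_Icc]
  have hlog : Real.log n ≤ Real.log ((n + 1 : ℕ) : ℝ) :=
    Real.log_le_log (by exact_mod_cast (show 0 < n by omega)) (by push_cast; linarith)
  linarith

/-- `log N ≤ Σ_{k=1}^{N−1} 1/k` (`N ≥ 1`), from `log(n + 1) ≤ H_n`. [folklore] -/
theorem bulkRing_harmonic_lower (hN : 1 ≤ N) :
    Real.log N ≤ ∑ k ∈ Finset.Ico 1 N, ((k : ℝ))⁻¹ := by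
  obtain ⟨n, rfl⟩ : ∃ n, N = n + 1 := ⟨N - 1, by omega⟩
  have h := log_add_one_le_harmonic n
  rw [harmonic_eq_sum_Icc] at h
  push_cast at h ⊢
  rwa [Finset.Ico_add_one_right_eq_Icc]

/-- **`T_N ≤ N(1 + log N)`**. [folklore] -/
theorem bulkRing_T_upper (hN : 3 ≤ N)
    (hc : ∀ k : ℕ, c k = Real.cos (2 * Real.pi * k / N) • e 0 + Real.sin (2 * Real.pi * k / N) • e 1) :
    ∑ k ∈ Finset.Ico 1 N, ‖c 0 - c k‖⁻¹ ≤ N * (1 + Real.log N) := by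
  have h := bulkRing_sum_bound hc 1
  simp only [pow_one] at h
  have hH := bulkRing_harmonic_upper hN
  have hlog : 0 ≤ Real.log N := Real.log_nonneg (by exact_mod_cast (show 1 ≤ N by omega))
  have hN0 : (0 : ℝ) ≤ N := Nat.cast_nonneg N
  have hm : 0 ≤ (N : ℝ) * (1 + Real.log N) := mul_nonneg hN0 (by linarith)
  calc _ ≤ 2 * ((N : ℝ) / 4) * ∑ k ∈ Finset.Ico 1 N, ((k : ℝ))⁻¹ := h
    _ ≤ 2 * ((N : ℝ) / 4) * (1 + Real.log N) := by gcongr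
    _ ≤ _ := by linarith

/-- **`T_N ≥ (N/2π) log(N/2)`** (indeed `≥ (N/2π) log N`, by `sin x ≤ x`). [folklore] -/
theorem bulkRing_T_lower (hN : 3 ≤ N)
    (hc : ∀ k : ℕ, c k = Real.cos (2 * Real.pi * k / N) • e 0 + Real.sin (2 * Real.pi * k / N) • e 1) :
    N / (2 * Real.pi) * Real.log (N / 2) ≤ ∑ k ∈ Finset.Ico 1 N, ‖c 0 - c k‖⁻¹ := by
  have hN0 : (0 : ℝ) < N := by exact_mod_cast (show 0 < N by omega)
  have hπ := Real.pi_pos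
  have hterm : ∀ k ∈ Finset.Ico 1 N, N / (2 * Real.pi) * ((k : ℝ))⁻¹ ≤ ‖c 0 - c k‖⁻¹ := by
    intro k hk
    rw [Finset.mem_Ico] at hk
    have hk0 : (0 : ℝ) < k := by exact_mod_cast hk.1
    have hle : ‖c 0 - c k‖ ≤ 2 * Real.pi * k / N := by
      rw [bulkRing_chord_zero hc hk.2.le]
      have := Real.sin_le (show 0 ≤ Real.pi * k / N by positivity)
      calc 2 * Real.sin (Real.pi * k / N) ≤ 2 * (Real.pi * k / N) := by linarith
        _ = _ := by ring
    have hpos : 0 < ‖c 0 - c k‖ := by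
      rcases bulkRing_dist_lower hc hk.1 hk.2 with h | h
      · exact lt_of_lt_of_le (by positivity) h
      · have : (0 : ℝ) < N - k := sub_pos.2 (by exact_mod_cast hk.2)
        exact lt_of_lt_of_le (div_pos (by linarith) hN0) h
    calc N / (2 * Real.pi) * ((k : ℝ))⁻¹ = (2 * Real.pi * k / N)⁻¹ := by field_simp
      _ ≤ ‖c 0 - c k‖⁻¹ := inv_anti₀ hpos hle
  calc N / (2 * Real.pi) * Real.log (N / 2) ≤ N / (2 * Real.pi) * Real.log N :=
        mul_le_mul_of_nonneg_left (Real.log_le_log (by positivity) (by linarith)) (by positivity)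
    _ ≤ N / (2 * Real.pi) * ∑ k ∈ Finset.Ico 1 N, ((k : ℝ))⁻¹ :=
        mul_le_mul_of_nonneg_left (bulkRing_harmonic_lower (by omega)) (by positivity)
    _ = ∑ k ∈ Finset.Ico 1 N, N / (2 * Real.pi) * ((k : ℝ))⁻¹ := by rw [Finset.mul_sum]
    _ ≤ _ := Finset.sum_le_sum hterm

/-- **`U_N ≤ N²`**. [folklore] -/
theorem bulkRing_U_upper
    (hc : ∀ k : ℕ, c k = Real.cos (2 * Real.pi * k / N) • e 0 + Real.sin (2 * Real.pi * k / N) • e 1) :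
    ∑ k ∈ Finset.Ico 1 N, (‖c 0 - c k‖ ^ 2)⁻¹ ≤ (N : ℝ) ^ 2 := by
  have h := bulkRing_sum_bound hc 2
  have h2 := sum_Ico_inv_sq_le_two N
  calc _ ≤ 2 * ((N : ℝ) / 4) ^ 2 * ∑ k ∈ Finset.Ico 1 N, ((k : ℝ) ^ 2)⁻¹ := h
    _ ≤ 2 * ((N : ℝ) / 4) ^ 2 * 2 := by gcongr
    _ ≤ _ := by nlinarith [sq_nonneg (N : ℝ)]

/-- **`V_N ≤ N³`**. [folklore] -/
theorem bulkRing_V_upper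
    (hc : ∀ k : ℕ, c k = Real.cos (2 * Real.pi * k / N) • e 0 + Real.sin (2 * Real.pi * k / N) • e 1) :
    ∑ k ∈ Finset.Ico 1 N, (‖c 0 - c k‖ ^ 3)⁻¹ ≤ (N : ℝ) ^ 3 := by
  have h := bulkRing_sum_bound hc 3
  have h3 : ∑ k ∈ Finset.Ico 1 N, ((k : ℝ) ^ 3)⁻¹ ≤ 2 := by
    refine le_trans (Finset.sum_le_sum fun k hk ↦ ?_) (sum_Ico_inv_sq_le_two N)
    rw [Finset.mem_Ico] at hk
    have hk1 : (1 : ℝ) ≤ k := by exact_mod_cast hk.1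
    exact inv_anti₀ (by positivity) (pow_le_pow_right₀ hk1 (by norm_num))
  have hN0 : (0 : ℝ) ≤ N := Nat.cast_nonneg N
  calc _ ≤ 2 * ((N : ℝ) / 4) ^ 3 * ∑ k ∈ Finset.Ico 1 N, ((k : ℝ) ^ 3)⁻¹ := h
    _ ≤ 2 * ((N : ℝ) / 4) ^ 3 * 2 := by gcongr
    _ ≤ _ := by nlinarith [pow_nonneg hN0 3]

/-! ## §5 The registered stub -/

/-- **Stub BK3a — `stub_bulkRing`** (geometry of the regular `N`-gon of puncture directions): unit norms,
`N`-periodicity, pairwise distance `≥ 4/N` (Jordan's inequality), `D_N`-symmetry of the Coulomb sums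
`Σ_{k≠j} ‖ĉ_j − ĉ_k‖⁻ᵖ` (`p = 1, 2, 3`), and their orders `T_N ≍ N log N`, `U_N ≲ N²`, `V_N ≲ N³`. [folklore] -/
theorem stub_bulkRing : ∀ (N : ℕ) (c : ℕ → E3), 3 ≤ N →
    (∀ k : ℕ, c k = Real.cos (2 * Real.pi * k / N) • e 0 + Real.sin (2 * Real.pi * k / N) • e 1) →
    (∀ k : ℕ, ‖c k‖ = 1) ∧ (∀ k : ℕ, c (k + N) = c k) ∧
    (∀ j k : ℕ, j < k → k < j + N → (4 : ℝ) / N ≤ ‖c j - c k‖) ∧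
    (∀ j ∈ Finset.Icc 1 N,
      ∑ k ∈ (Finset.Icc 1 N).erase j, ‖c j - c k‖⁻¹ = ∑ k ∈ Finset.Ico 1 N, ‖c 0 - c k‖⁻¹) ∧
    (∀ j ∈ Finset.Icc 1 N,
      ∑ k ∈ (Finset.Icc 1 N).erase j, (‖c j - c k‖ ^ 2)⁻¹ = ∑ k ∈ Finset.Ico 1 N, (‖c 0 - c k‖ ^ 2)⁻¹) ∧
    (∀ j ∈ Finset.Icc 1 N,
      ∑ k ∈ (Finset.Icc 1 N).erase j, (‖c j - c k‖ ^ 3)⁻¹ = ∑ k ∈ Finset.Ico 1 N, (‖c 0 - c k‖ ^ 3)⁻¹) ∧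
    (N / (2 * Real.pi) * Real.log (N / 2) ≤ ∑ k ∈ Finset.Ico 1 N, ‖c 0 - c k‖⁻¹) ∧
    (∑ k ∈ Finset.Ico 1 N, ‖c 0 - c k‖⁻¹ ≤ N * (1 + Real.log N)) ∧
    (∑ k ∈ Finset.Ico 1 N, (‖c 0 - c k‖ ^ 2)⁻¹ ≤ (N : ℝ) ^ 2) ∧
    (∑ k ∈ Finset.Ico 1 N, (‖c 0 - c k‖ ^ 3)⁻¹ ≤ (N : ℝ) ^ 3) := by
  intro N c hN hc
  exact ⟨bulkRing_norm_one hc, bulkRing_periodic hN hc, fun j k hjk hkj ↦ bulkRing_sep hc hjk hkj,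
    fun j hj ↦ bulkRing_sum_symm hN hc (fun x ↦ x⁻¹) hj,
    fun j hj ↦ bulkRing_sum_symm hN hc (fun x ↦ (x ^ 2)⁻¹) hj,
    fun j hj ↦ bulkRing_sum_symm hN hc (fun x ↦ (x ^ 3)⁻¹) hj,
    bulkRing_T_lower hN hc, bulkRing_T_upper hN hc, bulkRing_U_upper hc, bulkRing_V_upper hc⟩

end Summit.FinalStateConjecture.FinalStateConjecture.Theorems.SwallowTheDatum.ParametricKerrBurial

end
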